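import Literature.MathematicalPhysics.QuantumFieldTheory.Balaban1983to89.Node00.BgHierFrameGLOfRecord
import Summits.QuantumFields.YangMills.Theorems.BalabanUVNodesC44IterMhHierFrameLocality
import HarnessLib

/-!
# [B7] (82)–(88) ON `GL(N, ℂ)`: THE COMPLETED FRAME `h(V)(y) = e^{−f_k(σ_V)(y)}·Ψ_k(V♮)(y)` READS `V` ON THE BLOCK `B^k(y)` ONLY — (T3)∕(T4) DISCHARGED FOR
# node00-def-Y's GL INHABITANT `hierFrameGLDatumOfRecord` ((A1′) ✓`Node00.BgHierFrameGLOfRecord`)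

Cell `pub-ymgap` ∕ `ym-nodeO-ideate`, porter lineage `ymgap-nodeO-port-PTB-1` (gen 10); director-ym g24 №628 (1) (n1); `--kind proof --supports stmt-QuantumFields-27238 --as helper`;
count-neutral; NEW basename; the GL twin of ✓`…C44IterMhHierFrameLocality`.  [B7] = [Balaban1985Averaging]; [B4] = [Balaban1984PropagatorsI]; [I] = [Balaban1987RG1].

WHAT THIS FILE DOES.  (A1′)'s completed frame is `e^{−abFrameL k (detLogField U₀ V) y} • Ψ_k(naturalField U₀ V)(y)`: the determinant coordinate `σ_V = detLogField U₀ V` and the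
det-normalisation `V♮ = naturalField U₀ V` are POINTWISE in the bond, the matrix frame pair `(Φ_k, Ψ_k)` is block-local by ✓`framePair_apply_congr_of_eqOn_bondsIn`, and the abelian
frame functional `f_k = abFrameL k` (recursion (84)–(88) in logarithmic coordinates over the abelian iterate `iterSumL` and the centre-contour sums `ctrSumL`) is block-local by
the same induction, run here on the abelian letters:
* §1 `walkSumL_congr` · `loopSumL_congr₂` · `axialSumL_congr₂` · `avgSumL_apply_congr₂` (the abelian one-step averaging is two-block local) · `avgSumL_apply_congr_of_eqOn_bondsIn` ·
  ★ `iterSumL_apply_congr_of_eqOn_bondsIn` · `ctrSumL_congr₁` · `ctrSumL_congr_of_eqOn_bondsIn` · ★★ `abFrameL_apply_congr_of_eqOn_bondsIn`.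
* §2 `detLogField_congr_of_eqOn_bondsIn` · `naturalField_congr_of_eqOn_bondsIn` · ★ `hierFrameGLMap_congr_of_eqOn_bondsIn` ∕ `hierFrameGLInv_congr_of_eqOn_bondsIn` ·
  ★★ `hierFrameGLDatumOfRecord_map_inv_congr_of_eqOn_bondsIn` = (hmap) VERBATIM at `𝔥 := hierFrameGLDatumOfRecord F N k U₀` (unconditional: off the guard the datum is frameless) ·
  ★ `hierFrameGLDatumOfRecord_deriv_congr_of_eqOn_bondsIn` = (hderiv) VERBATIM.

HONEST FRAMING.  Lattice bookkeeping over landed letters ([I] (0.3)∕(0.4), [B4] (1.8) locators; [B7] p.30: `R^{(j)}_{0,y}` depends on `V|B^j(y)`); NO estimate ((81), (101)–(112)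
untouched: the window∕near-one debts (T1)∕(T2) stay DISPLAYED); nothing of [B7] Prop. 5 ∕ [B11] Prop. 4 proved; K0ᴬ ⟨stmt-QuantumFields-27238⟩ NOT closed; NODE O 0∕1; COUNT 8∕28 ·
K 1∕4 UNMOVED; finite `𝕋⁴_{L^K}` at fixed ε — NOT continuum ∕ OS ∕ Clay; **the Yang–Mills mass gap (Clay) is NOT proved by any of this.**  No `sorry`, `instance`, `notation`,
`set_option`; standard axioms.
-/

noncomputable section

open scoped Matrix Matrix.Norms.L2Operator Topology

namespace Summit.QuantumFields.YangMills.Theorems.C44IterMh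

open Literature.MathematicalPhysics.QuantumFieldTheory.Balaban1983to89
open Literature.MathematicalPhysics.QuantumFieldTheory.Balaban1983to89.Node00
open T4Continuum BlockAveraging
open B15AveragingHolomorphicLocal (eq_line_of_mem_walk_replicate)
open B12B0LoopGeometry267 (stair_src_tgt_blockOf)
open B10Eq42TorusConstraint (bondsIn mem_bondsIn_iff)
open B10Eq38TorusDomains (toFine)
open BlockAveragingEMLLinearised (walkSum walkSum_nil walkSum_cons)

/-! ## §1  The abelian letters of (A1′) are block-local -/

section Abelian

variable {P : Params} {j : ℕ}

/-- An abelian walk sum reads the field on the walk's bonds only. [cite: Balaban1984PropagatorsI, (1.8) p.19 (bookkeeping)] -/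
theorem walkSumL_congr {s s' : PBond P j → ℂ} : ∀ {γ : List (LStep P j)}, (∀ st ∈ γ, s st.bond = s' st.bond) → walkSumL γ s = walkSumL γ s'
  | [], _ => by rw [walkSumL_apply, walkSumL_apply, walkSum_nil, walkSum_nil]
  | st :: γ, h => by
    have ih : walkSumL γ s = walkSumL γ s' := walkSumL_congr fun st' hst' => h st' (List.mem_cons_of_mem _ hst')
    rw [walkSumL_apply, walkSumL_apply] at ih
    rw [walkSumL_apply, walkSumL_apply, walkSum_cons, walkSum_cons, h st List.mem_cons_self, ih]

/-- The abelian loop flux at `c` reads the field only on bonds with both ends in `B(c₋) ∪ B(c₊)`. [cite: Balaban1987RG1, (0.4) p.253] -/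
theorem loopSumL_congr₂ (hj : j + 1 ≤ P.m + P.K) {s s' : PBond P j → ℂ} (c : PBond P (j + 1))
    (hss' : ∀ b : PBond P j, (blockOf b.src = c.src ∨ blockOf b.src = c.tgt) → (blockOf b.tgt = c.src ∨ blockOf b.tgt = c.tgt) → s b = s' b)
    (i : Idx P) : loopSumL c i s = loopSumL c i s' :=
  walkSumL_congr fun st hst => hss' st.bond (blockOf_src_of_mem_walk hj c i st hst) (T4ReflectionConeSharp.blockOf_tgt_of_mem_walk hj c i st hst)

/-- The abelian axial sum at `c` reads the field only on bonds with both ends in `B(c₋) ∪ B(c₊)`. [cite: Balaban1984PropagatorsI, (1.7) p.18] -/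
theorem axialSumL_congr₂ (hj : j + 1 ≤ P.m + P.K) {s s' : PBond P j → ℂ} (c : PBond P (j + 1))
    (hss' : ∀ b : PBond P j, (blockOf b.src = c.src ∨ blockOf b.src = c.tgt) → (blockOf b.tgt = c.src ∨ blockOf b.tgt = c.tgt) → s b = s' b) :
    axialSumL c s = axialSumL c s' :=
  walkSumL_congr fun st hst => by
    obtain ⟨t, ht, rfl⟩ := eq_line_of_mem_walk_replicate c P.L st hst
    exact hss' _ (AveragingRT.blockOf_lineSite hj c ht) (T4ReflectionConeSharp.blockOf_tgt_line hj c ht)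

/-- ★ **THE ABELIAN ONE-STEP AVERAGING IS TWO-BLOCK LOCAL.** [cite: Balaban1987RG1, (0.4) p.253] -/
theorem avgSumL_apply_congr₂ (hj : j + 1 ≤ P.m + P.K) {s s' : PBond P j → ℂ} (c : PBond P (j + 1))
    (hss' : ∀ b : PBond P j, (blockOf b.src = c.src ∨ blockOf b.src = c.tgt) → (blockOf b.tgt = c.src ∨ blockOf b.tgt = c.tgt) → s b = s' b) :
    avgSumL s c = avgSumL s' c := by
  rw [avgSumL_apply, avgSumL_apply, axialSumL_congr₂ hj c hss']
  congr 2
  exact Finset.sum_congr rfl fun i _ => loopSumL_congr₂ hj c hss' i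

/-- On a fine region `Y` saturated at level `j+1`, two level-`j` scalar fields agreeing on `bondsIn j Y` have the same abelian average on `bondsIn (j+1) Y`.
[cite: Balaban1987RG1, (0.4) p.253 (bookkeeping)] -/
theorem avgSumL_apply_congr_of_eqOn_bondsIn (hj : j + 1 ≤ P.m + P.K) {Y : Set (Site P 0)}
    (hY : ∀ x : Site P j, toFine j x ∈ Y ↔ toFine (j + 1) (blockOf x) ∈ Y)
    {s s' : PBond P j → ℂ} (hss' : ∀ b : PBond P j, b ∈ bondsIn j Y → s b = s' b)
    {c : PBond P (j + 1)} (hc : c ∈ bondsIn (j + 1) Y) : avgSumL s c = avgSumL s' c := by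
  rw [mem_bondsIn_iff] at hc
  have hblk : ∀ x : Site P j, (blockOf x = c.src ∨ blockOf x = c.tgt) → toFine j x ∈ Y := by
    intro x hx
    refine (hY x).2 ?_
    rcases hx with h | h
    · rw [h]; exact hc.1
    · rw [h]; exact hc.2
  refine avgSumL_apply_congr₂ hj c fun b h₁ h₂ => hss' b ?_
  rw [mem_bondsIn_iff]
  exact ⟨hblk _ h₁, hblk _ h₂⟩

/-- ★ **THE ABELIAN ITERATE ON A SATURATED REGION READS THE REGION ONLY.** [cite: Balaban1987RG1, (0.4) p.253, (0.21) p.256; Balaban1985Averaging, (88) p.31 (bookkeeping)] -/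
theorem iterSumL_apply_congr_of_eqOn_bondsIn {Y : Set (Site P 0)} :
    ∀ (k : ℕ), k ≤ P.m + P.K → (∀ j, j < k → ∀ x : Site P j, toFine j x ∈ Y ↔ toFine (j + 1) (blockOf x) ∈ Y) →
      ∀ {s s' : PBond P 0 → ℂ}, (∀ b : PBond P 0, b ∈ bondsIn 0 Y → s b = s' b) →
        ∀ c : PBond P k, c ∈ bondsIn k Y → iterSumL k s c = iterSumL k s' c
  | 0, _, _, _, _, hss', c, hc => hss' c hc
  | k + 1, hk, hY, _, _, hss', c, hc => by
    rw [iterSumL, LinearMap.comp_apply, LinearMap.comp_apply]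
    exact avgSumL_apply_congr_of_eqOn_bondsIn hk (hY k (Nat.lt_succ_self k))
      (fun b hb => iterSumL_apply_congr_of_eqOn_bondsIn k (Nat.le_of_succ_le hk) (fun j hj => hY j (Nat.lt_succ_of_lt hj)) hss' b hb) hc

/-- The abelian centre-contour sum `s(Γ_{y,x_r})` reads `s` only on bonds with both ends in `B(y)`. [cite: Balaban1987RG1, (0.3) p.252; Balaban1985Averaging, (78) p.30] -/
theorem ctrSumL_congr₁ (hj : j + 1 ≤ P.m + P.K) {s s' : PBond P j → ℂ} (y : Site P (j + 1)) (r : Fin P.d → Fin P.L)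
    (hss' : ∀ b : PBond P j, blockOf b.src = y → blockOf b.tgt = y → s b = s' b) : ctrSumL y r s = ctrSumL y r s' := by
  unfold ctrSumL ctrWord
  exact walkSumL_congr fun st hst => by
    obtain ⟨h₁, h₂⟩ := stair_src_tgt_blockOf hj y (Equiv.refl _) r st hst
    exact hss' _ h₁ h₂

/-- On a fine region `Y` saturated at level `j+1`, two level-`j` scalar fields agreeing on `bondsIn j Y` have the same centre-contour sums at every `y` with
`toFine (j+1) y ∈ Y`. [cite: Balaban1987RG1, (0.3) p.252 (bookkeeping)] -/
theorem ctrSumL_congr_of_eqOn_bondsIn (hj : j + 1 ≤ P.m + P.K) {Y : Set (Site P 0)}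
    (hY : ∀ x : Site P j, toFine j x ∈ Y ↔ toFine (j + 1) (blockOf x) ∈ Y)
    {s s' : PBond P j → ℂ} (hss' : ∀ b : PBond P j, b ∈ bondsIn j Y → s b = s' b)
    {y : Site P (j + 1)} (hy : toFine (j + 1) y ∈ Y) (r : Fin P.d → Fin P.L) : ctrSumL y r s = ctrSumL y r s' := by
  refine ctrSumL_congr₁ hj y r fun b h₁ h₂ => hss' b (mem_bondsIn_iff.2 ⟨(hY _).2 ?_, (hY _).2 ?_⟩)
  · rwa [h₁]
  · exact (show blockOf b.tgt = y from h₂) ▸ hy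

/-- ★★ **THE ABELIAN FRAME FUNCTIONAL `f_k(s)(y)` READS `s` ON THE BLOCK `B^k(y)` ONLY** (induction on the recursion (84)–(88) in logarithmic coordinates: the iterate along the
centre contours inside `B(y)` and `f_{k}` at the block sites). [cite: Balaban1985Averaging, (82)–(88) pp.30–31; Balaban1987RG1, (0.3)–(0.4) pp.252–253] -/
theorem abFrameL_apply_congr_of_eqOn_bondsIn {Y : Set (Site P 0)} :
    ∀ (k : ℕ), k ≤ P.m + P.K → (∀ j, j < k → ∀ x : Site P j, toFine j x ∈ Y ↔ toFine (j + 1) (blockOf x) ∈ Y) →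
      ∀ {s s' : PBond P 0 → ℂ}, (∀ b : PBond P 0, b ∈ bondsIn 0 Y → s b = s' b) →
        ∀ y : Site P k, toFine k y ∈ Y → abFrameL k s y = abFrameL k s' y
  | 0, _, _, _, _, _, y, _ => by rw [abFrameL_zero, LinearMap.zero_apply, LinearMap.zero_apply]
  | k + 1, hk, hY, s, s', hss', y, hy => by
    have hYk := hY k (Nat.lt_succ_self k)
    have ih : ∀ x : Site P k, toFine k x ∈ Y → abFrameL k s x = abFrameL k s' x :=
      abFrameL_apply_congr_of_eqOn_bondsIn k (Nat.le_of_succ_le hk) (fun j hj => hY j (Nat.lt_succ_of_lt hj)) hss'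
    rw [abFrameL_succ_apply, abFrameL_succ_apply]
    congr 1
    refine Finset.sum_congr rfl fun r _ => ?_
    rw [ih _ ((hYk _).2 (by rwa [Site.blockOf_blockSite hk])),
      ctrSumL_congr_of_eqOn_bondsIn hk hYk
        (fun b hb => iterSumL_apply_congr_of_eqOn_bondsIn k (Nat.le_of_succ_le hk) (fun j hj => hY j (Nat.lt_succ_of_lt hj)) hss' b hb) hy r]

end Abelian

/-! ## §2  (hmap) and (hderiv) for the GL inhabitant `hierFrameGLDatumOfRecord F N k U₀` -/

section Pointwise

variable {P : Params} {N : ℕ} (U₀ : GaugeField P 0 (SU N))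

/-- The determinant coordinate is POINTWISE in the bond: `σ_V(b)` reads `V(b)` only. [cite: Balaban1985Variational, (15) p.280, p.307 (bookkeeping)] -/
theorem detLogField_congr_of_eqOn {Y : Set (Site P 0)} {V V' : PBond P 0 → Matrix (Fin N) (Fin N) ℂ}
    (hVV' : ∀ b : PBond P 0, b ∈ bondsIn 0 Y → V b = V' b) : ∀ b : PBond P 0, b ∈ bondsIn 0 Y → detLogField U₀ V b = detLogField U₀ V' b :=
  fun b hb => by rw [detLogField_apply, detLogField_apply, hVV' b hb]

/-- The det-normalisation is POINTWISE in the bond: `V♮(b)` reads `V(b)` only. [cite: Balaban1985Variational, (15) p.280, p.307 (bookkeeping)] -/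
theorem naturalField_congr_of_eqOn {Y : Set (Site P 0)} {V V' : PBond P 0 → Matrix (Fin N) (Fin N) ℂ}
    (hVV' : ∀ b : PBond P 0, b ∈ bondsIn 0 Y → V b = V' b) : ∀ b : PBond P 0, b ∈ bondsIn 0 Y → naturalField U₀ V b = naturalField U₀ V' b :=
  fun b hb => by rw [naturalField_apply, naturalField_apply, detLogField_congr_of_eqOn U₀ hVV' b hb, hVV' b hb]

end Pointwise

section RecordGL

variable (F : T4Family) (N : ℕ) [NeZero N] {K : ℕ} (k : ℕ) (U₀ : GaugeField (F.P K) 0 (SU N))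

/-- ★ **THE COMPLETED FRAME `h(V)(y)` READS `V` ON `B^k(y)` ONLY.** [cite: Balaban1985Averaging, (82)–(88) pp.30–31; Balaban1985Variational, (21) p.281, p.307] -/
theorem hierFrameGLMap_congr_of_eqOn_bondsIn (hk : k ≤ (F.P K).m + (F.P K).K) {Y : Set (Site (F.P K) 0)}
    (hY : ∀ i, i < k → ∀ x : Site (F.P K) i, toFine i x ∈ Y ↔ toFine (i + 1) (blockOf x) ∈ Y)
    {V V' : PBond (F.P K) 0 → Matrix (Fin N) (Fin N) ℂ} (hVV' : ∀ b : PBond (F.P K) 0, b ∈ bondsIn 0 Y → V b = V' b)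
    {y : Site (F.P K) k} (hy : toFine k y ∈ Y) : hierFrameGLMap F N k U₀ V y = hierFrameGLMap F N k U₀ V' y := by
  rw [hierFrameGLMap, hierFrameGLMap, abFrameL_apply_congr_of_eqOn_bondsIn k hk hY (detLogField_congr_of_eqOn U₀ hVV') y hy,
    framePair_apply_congr_of_eqOn_bondsIn (avOfRecord F N K) U₀ k hk hY (naturalField_congr_of_eqOn U₀ hVV') y hy]

/-- ★ **THE COMPLETED INVERSE FRAME `h(V)⁻¹(y)` READS `V` ON `B^k(y)` ONLY.** [cite: Balaban1985Averaging, (82)–(88) pp.30–31; Balaban1985Variational, (21) p.281, p.307] -/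
theorem hierFrameGLInv_congr_of_eqOn_bondsIn (hk : k ≤ (F.P K).m + (F.P K).K) {Y : Set (Site (F.P K) 0)}
    (hY : ∀ i, i < k → ∀ x : Site (F.P K) i, toFine i x ∈ Y ↔ toFine (i + 1) (blockOf x) ∈ Y)
    {V V' : PBond (F.P K) 0 → Matrix (Fin N) (Fin N) ℂ} (hVV' : ∀ b : PBond (F.P K) 0, b ∈ bondsIn 0 Y → V b = V' b)
    {y : Site (F.P K) k} (hy : toFine k y ∈ Y) : hierFrameGLInv F N k U₀ V y = hierFrameGLInv F N k U₀ V' y := by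
  rw [hierFrameGLInv, hierFrameGLInv, abFrameL_apply_congr_of_eqOn_bondsIn k hk hY (detLogField_congr_of_eqOn U₀ hVV') y hy,
    framePair_apply_congr_of_eqOn_bondsIn (avOfRecord F N K) U₀ k hk hY (naturalField_congr_of_eqOn U₀ hVV') y hy]

/-- ★★ **(hmap) FOR THE RECORD'S GL FRAME DATUM**, verbatim in the shape PT-B's framed doors display, DISCHARGED (on the guard: the two rows above; off the guard the datum is
frameless, `h = h⁻¹ = 1`). [cite: Balaban1985Averaging, (82)–(88) pp.30–31, (92) p.31; Balaban1985Variational, p.307] -/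
theorem hierFrameGLDatumOfRecord_map_inv_congr_of_eqOn_bondsIn (hk : k ≤ (F.P K).m + (F.P K).K) :
    ∀ Y : Set (Site (F.P K) 0), (∀ i, i < k → ∀ s : Site (F.P K) i, toFine i s ∈ Y ↔ toFine (i + 1) (blockOf s) ∈ Y) →
      ∀ V V' : PBond (F.P K) 0 → Matrix (Fin N) (Fin N) ℂ, (∀ b : PBond (F.P K) 0, b ∈ bondsIn 0 Y → V b = V' b) →
      ∀ y : Site (F.P K) k, toFine k y ∈ Y →
        (hierFrameGLDatumOfRecord F N k U₀).map V y = (hierFrameGLDatumOfRecord F N k U₀).map V' y ∧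
          (hierFrameGLDatumOfRecord F N k U₀).inv V y = (hierFrameGLDatumOfRecord F N k U₀).inv V' y := by
  intro Y hY V V' hVV' y hy
  by_cases hU₀ : SmallBelow (avOfRecord F N K) k U₀
  · rw [hierFrameGLDatumOfRecord_map F N k U₀ hU₀, hierFrameGLDatumOfRecord_inv F N k U₀ hU₀]
    exact ⟨hierFrameGLMap_congr_of_eqOn_bondsIn F N k U₀ hk hY hVV' hy, hierFrameGLInv_congr_of_eqOn_bondsIn F N k U₀ hk hY hVV' hy⟩
  · rw [hierFrameGLDatumOfRecord_of_not_smallBelow F N k U₀ hU₀]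
    exact ⟨rfl, rfl⟩

/-- ★ **(hderiv) FOR THE RECORD'S GL FRAME DATUM** (from (hmap) by ✓`FrameDatum.deriv_apply_congr_of_map_congr`).
[cite: Balaban1985Averaging, (82)–(88) pp.30–31; Balaban1985BackgroundPropagators, (3.113) p.418] -/
theorem hierFrameGLDatumOfRecord_deriv_congr_of_eqOn_bondsIn (hk : k ≤ (F.P K).m + (F.P K).K) :
    ∀ Y : Set (Site (F.P K) 0), (∀ i, i < k → ∀ s : Site (F.P K) i, toFine i s ∈ Y ↔ toFine (i + 1) (blockOf s) ∈ Y) →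
      ∀ Z Z' : PBond (F.P K) 0 → Matrix (Fin N) (Fin N) ℂ, (∀ b : PBond (F.P K) 0, b ∈ bondsIn 0 Y → Z b = Z' b) →
      ∀ y : Site (F.P K) k, toFine k y ∈ Y → (hierFrameGLDatumOfRecord F N k U₀).deriv Z y = (hierFrameGLDatumOfRecord F N k U₀).deriv Z' y :=
  fun Y hY _ _ hZZ' _ hy =>
    FrameDatum.deriv_apply_congr_of_map_congr (hierFrameGLDatumOfRecord F N k U₀)
      (fun V V' hVV' y hy => (hierFrameGLDatumOfRecord_map_inv_congr_of_eqOn_bondsIn F N k U₀ hk Y hY V V' hVV' y hy).1) hZZ' hy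

end RecordGL

end Summit.QuantumFields.YangMills.Theorems.C44IterMh

end
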